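import Mathlib
import Summits.Ventures.PercRepro2.PrefMonoGlue
import Summits.Ventures.PercRepro2.PrefMonoClasses
import Summits.Ventures.PercRepro2.PrefMono

/-!
# The two odds `ν(v ∈ C₁)/ν(v ∉ U)` and `ν(v ∈ C₂)/ν(v ∉ U)` grow with every edge at `v`
(blind cell PercRepro2, mine-c g29; `conjectures/MINE-C.md` §38.6 — the remaining `b`-free monotone
objects of §37.18, by the same two BHK brackets `bhk_a`, `bhk_b` of `PrefMono.lean`)

`odds₁_mono`: `P_t(E)/P_t(A) = ν(v ∈ C₁)/ν(v ∉ C₁ ∪ C₂)` is non-decreasing in the weight of an edge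
`e = {v, y}` at `v` (`E₁ A₀ − E₀ A₁ = bb + c₀₁ (a + m) ≥ 0`); `odds₂_mono`: so is
`P_t(N ∩ {v ∈ C₂})/P_t(A) = ν(v ∈ C₂)/ν(v ∉ C₁ ∪ C₂)` (`M₁ A₀ − M₀ A₁ = ba + c₀₂ (a + m₂) ≥ 0`).
-/

namespace Summit.Ventures.PercRepro2

namespace PrefMono

variable {V : Type*} {E : Type*} [Fintype V] [DecidableEq V] [Fintype E] [DecidableEq E]
  {R : Type*} [Field R] [LinearOrder R] [IsStrictOrderedRing R]

section Odds

variable (p : E → R) (ends : E → Sym2 V) {e : E} {v y : V}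

/-- **The odds of joining `a₁`**: `P_t(E)/P_t(A)` is non-decreasing in the weight `t` of an edge
`e = {v, y}` at `v` (for `s ≤ t`, wherever `P_s(A), P_t(A) > 0`). -/
theorem odds₁_mono (hp : IsProbVec p) (hends : ends e = s(v, y)) (a₁ a₂ : V) {s t : R}
    (hst : s ≤ t)
    (hAs : 0 < prob (Function.update p e s) (AEvent ends a₁ a₂ v))
    (hAt : 0 < prob (Function.update p e t) (AEvent ends a₁ a₂ v)) :
    prob (Function.update p e s) (EEvent ends a₁ a₂ v) /
        prob (Function.update p e s) (AEvent ends a₁ a₂ v) ≤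
      prob (Function.update p e t) (EEvent ends a₁ a₂ v) /
        prob (Function.update p e t) (AEvent ends a₁ a₂ v) := by
  have hp₀ : IsProbVec (Function.update p e 0) := hp.update e le_rfl zero_le_one
  rw [div_le_div_iff₀ hAs hAt]
  have h00 : 0 ≤ prob (Function.update p e 0) (Z00 ends a₁ a₂ v y) := prob_nonneg hp₀ _
  have h01 : 0 ≤ prob (Function.update p e 0) (Z01 ends a₁ a₂ v y) := prob_nonneg hp₀ _
  have h02 : 0 ≤ prob (Function.update p e 0) (Z02 ends a₁ a₂ v y) := prob_nonneg hp₀ _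
  have h1n : 0 ≤ prob (Function.update p e 0) (Z1n ends a₁ a₂ v y) := prob_nonneg hp₀ _
  have h12 : 0 ≤ prob (Function.update p e 0) (Z12 ends a₁ a₂ v y) := prob_nonneg hp₀ _
  have hE0 := E_eq (Function.update p e 0) ends a₁ a₂ v y
  have hA0 := A_eq (Function.update p e 0) ends a₁ a₂ v y
  have hE1 := E_one p ends a₁ a₂ hends
  have hA1 := A_one p ends a₁ a₂ hends
  have hbb : 0 ≤ (prob (Function.update p e 0) (Z1n ends a₁ a₂ v y) +
      prob (Function.update p e 0) (Z12 ends a₁ a₂ v y)) *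
        prob (Function.update p e 0) (Z02 ends a₁ a₂ v y) -
      (prob (Function.update p e 0) (Z01 ends a₁ a₂ v y) +
        prob (Function.update p e 0) (Z02 ends a₁ a₂ v y) +
        prob (Function.update p e 0) (Z00 ends a₁ a₂ v y)) *
        prob (Function.update p e 0) (Z12 ends a₁ a₂ v y) := by
    have := bhk_b (Function.update p e 0) ends a₁ a₂ v y hp₀
    rw [hE0, hA0] at this
    linarith [this]
  rw [OneRootDrop.prob_update_eq_pin p s (EEvent ends a₁ a₂ v),
    OneRootDrop.prob_update_eq_pin p s (AEvent ends a₁ a₂ v),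
    OneRootDrop.prob_update_eq_pin p t (EEvent ends a₁ a₂ v),
    OneRootDrop.prob_update_eq_pin p t (AEvent ends a₁ a₂ v), hE0, hA0, hE1, hA1]
  set c00 := prob (Function.update p e 0) (Z00 ends a₁ a₂ v y)
  set c01 := prob (Function.update p e 0) (Z01 ends a₁ a₂ v y)
  set c02 := prob (Function.update p e 0) (Z02 ends a₁ a₂ v y)
  set c1n := prob (Function.update p e 0) (Z1n ends a₁ a₂ v y)
  set c12 := prob (Function.update p e 0) (Z12 ends a₁ a₂ v y)
  -- `E₁ A₀ − E₀ A₁ = bb + c₀₁ (c₀₀ + c₀₁ + c₀₂ + c₁ₙ + c₁₂) ≥ 0`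
  have hkey : 0 ≤ (c01 + c1n) * (c01 + c02 + c00) - (c1n + c12) * c00 := by
    have : (c01 + c1n) * (c01 + c02 + c00) - (c1n + c12) * c00 =
        ((c1n + c12) * c02 - (c01 + c02 + c00) * c12) + c01 * (c00 + c01 + c02 + c1n + c12) := by
      ring
    rw [this]
    exact add_nonneg hbb (mul_nonneg h01 (by positivity))
  have hts : 0 ≤ t - s := by linarith
  have hid : (t * (c01 + c1n) + (1 - t) * (c1n + c12)) * (s * c00 + (1 - s) * (c01 + c02 + c00)) -
      (s * (c01 + c1n) + (1 - s) * (c1n + c12)) * (t * c00 + (1 - t) * (c01 + c02 + c00)) =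
      (t - s) * ((c01 + c1n) * (c01 + c02 + c00) - (c1n + c12) * c00) := by
    ring
  linarith only [mul_nonneg hts hkey, hid]

/-- **The odds of joining `a₂`**: `P_t(N ∩ {v ∈ C₂})/P_t(A)` is non-decreasing in the weight `t` of
an edge `e = {v, y}` at `v` (for `s ≤ t`, wherever `P_s(A), P_t(A) > 0`). -/
theorem odds₂_mono (hp : IsProbVec p) (hends : ends e = s(v, y)) (a₁ a₂ : V) {s t : R}
    (hst : s ≤ t)
    (hAs : 0 < prob (Function.update p e s) (AEvent ends a₁ a₂ v))
    (hAt : 0 < prob (Function.update p e t) (AEvent ends a₁ a₂ v)) :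
    prob (Function.update p e s) (TwoRootLean.NEvent ends a₁ a₂ v ∩ connEvent ends a₂ v) /
        prob (Function.update p e s) (AEvent ends a₁ a₂ v) ≤
      prob (Function.update p e t) (TwoRootLean.NEvent ends a₁ a₂ v ∩ connEvent ends a₂ v) /
        prob (Function.update p e t) (AEvent ends a₁ a₂ v) := by
  have hp₀ : IsProbVec (Function.update p e 0) := hp.update e le_rfl zero_le_one
  rw [div_le_div_iff₀ hAs hAt]
  have h00 : 0 ≤ prob (Function.update p e 0) (Z00 ends a₁ a₂ v y) := prob_nonneg hp₀ _
  have h01 : 0 ≤ prob (Function.update p e 0) (Z01 ends a₁ a₂ v y) := prob_nonneg hp₀ _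
  have h02 : 0 ≤ prob (Function.update p e 0) (Z02 ends a₁ a₂ v y) := prob_nonneg hp₀ _
  have h2n : 0 ≤ prob (Function.update p e 0) (Z2n ends a₁ a₂ v y) := prob_nonneg hp₀ _
  have h21 : 0 ≤ prob (Function.update p e 0) (Z21 ends a₁ a₂ v y) := prob_nonneg hp₀ _
  have hA0 := A_eq (Function.update p e 0) ends a₁ a₂ v y
  have hM0 := M2_eq (Function.update p e 0) ends a₁ a₂ v y
  have hN0 : prob (Function.update p e 0) (TwoRootLean.NEvent ends a₁ a₂ v) =
      prob (Function.update p e 0) (Z21 ends a₁ a₂ v y) +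
        prob (Function.update p e 0) (Z2n ends a₁ a₂ v y) +
        (prob (Function.update p e 0) (Z01 ends a₁ a₂ v y) +
          prob (Function.update p e 0) (Z02 ends a₁ a₂ v y) +
          prob (Function.update p e 0) (Z00 ends a₁ a₂ v y)) := by
    rw [N_eq_M2_add_A (Function.update p e 0) ends a₁ a₂ v, hM0, hA0]
  -- the glued mass of `N ∩ {v ∈ C₂}` is `P₁(N) − P₁(A) = c₀₂ + c₂ₙ`
  have hM1 : prob (Function.update p e 1) (TwoRootLean.NEvent ends a₁ a₂ v ∩ connEvent ends a₂ v) =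
      prob (Function.update p e 0) (Z02 ends a₁ a₂ v y) +
        prob (Function.update p e 0) (Z2n ends a₁ a₂ v y) := by
    have h := N_eq_M2_add_A (Function.update p e 1) ends a₁ a₂ v
    rw [N_one p ends a₁ a₂ hends, A_one p ends a₁ a₂ hends] at h
    linarith [h]
  have hA1 := A_one p ends a₁ a₂ hends
  have hba : 0 ≤ (prob (Function.update p e 0) (Z2n ends a₁ a₂ v y) +
      prob (Function.update p e 0) (Z21 ends a₁ a₂ v y)) *
        prob (Function.update p e 0) (Z01 ends a₁ a₂ v y) -
      (prob (Function.update p e 0) (Z01 ends a₁ a₂ v y) +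
        prob (Function.update p e 0) (Z02 ends a₁ a₂ v y) +
        prob (Function.update p e 0) (Z00 ends a₁ a₂ v y)) *
        prob (Function.update p e 0) (Z21 ends a₁ a₂ v y) := by
    have := bhk_a (Function.update p e 0) ends a₁ a₂ v y hp₀
    rw [hN0] at this
    linarith [this]
  rw [OneRootDrop.prob_update_eq_pin p s (TwoRootLean.NEvent ends a₁ a₂ v ∩ connEvent ends a₂ v),
    OneRootDrop.prob_update_eq_pin p s (AEvent ends a₁ a₂ v),
    OneRootDrop.prob_update_eq_pin p t (TwoRootLean.NEvent ends a₁ a₂ v ∩ connEvent ends a₂ v),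
    OneRootDrop.prob_update_eq_pin p t (AEvent ends a₁ a₂ v), hM0, hA0, hM1, hA1]
  set c00 := prob (Function.update p e 0) (Z00 ends a₁ a₂ v y)
  set c01 := prob (Function.update p e 0) (Z01 ends a₁ a₂ v y)
  set c02 := prob (Function.update p e 0) (Z02 ends a₁ a₂ v y)
  set c2n := prob (Function.update p e 0) (Z2n ends a₁ a₂ v y)
  set c21 := prob (Function.update p e 0) (Z21 ends a₁ a₂ v y)
  -- `M₁ A₀ − M₀ A₁ = ba + c₀₂ (c₀₀ + c₀₁ + c₀₂ + c₂ₙ + c₂₁) ≥ 0`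
  have hkey : 0 ≤ (c02 + c2n) * (c01 + c02 + c00) - (c21 + c2n) * c00 := by
    have : (c02 + c2n) * (c01 + c02 + c00) - (c21 + c2n) * c00 =
        ((c2n + c21) * c01 - (c01 + c02 + c00) * c21) + c02 * (c00 + c01 + c02 + c2n + c21) := by
      ring
    rw [this]
    exact add_nonneg hba (mul_nonneg h02 (by positivity))
  have hts : 0 ≤ t - s := by linarith
  have hid : (t * (c02 + c2n) + (1 - t) * (c21 + c2n)) * (s * c00 + (1 - s) * (c01 + c02 + c00)) -
      (s * (c02 + c2n) + (1 - s) * (c21 + c2n)) * (t * c00 + (1 - t) * (c01 + c02 + c00)) =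
      (t - s) * ((c02 + c2n) * (c01 + c02 + c00) - (c21 + c2n) * c00) := by
    ring
  linarith only [mul_nonneg hts hkey, hid]

end Odds

end PrefMono

end Summit.Ventures.PercRepro2
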